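import Mathlib
import HarnessLib
import Summits.QuantumFields.YangMills.Theses.PencilRigidity
import Literature.MathematicalPhysics.QuantumFieldTheory.OSReconstructionNoE1Proofs
import Summits.QuantumFields.YangMills.Theorems.PencilRigidityCurvatureKernelBoundKernelPinning
import Summits.QuantumFields.YangMills.Theorems.PencilRigidityCurvatureKernelBoundHalfSpaceKernelBumps
import Summits.QuantumFields.YangMills.Theorems.PencilRigidityCurvatureKernelBoundHalfSpaceKernelCluster
import Summits.QuantumFields.YangMills.Theorems.PencilRigidityCurvatureKernelBoundHalfSpaceKernelRiemann
import Summits.QuantumFields.YangMills.Theorems.PencilRigidityCurvatureKernelBoundHalfSpaceKernelTensor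

/-!
# `CurvatureKernelBound` — stub H `HalfSpaceKernel`: the stub

(support for stmt-QuantumFields-11687, line `sixteen-charts-analytic-kernel`, skeleton v11)

`HalfSpaceKernel` (registered signature verbatim), assembled from the helper files
`…HalfSpaceKernel{Cluster,Riemann,FieldVec,Bumps,LocalNorm,RiemannLimit,RiemannNorm,Identification,Tensor}`.
-/

noncomputable section

open scoped BigOperators Topology SchwartzMap ComplexConjugate InnerProductSpace
open MeasureTheory Filter Set Metric
open Literature.MathematicalPhysics.QuantumLattice Literature.MathematicalPhysics.AQFT
open Literature.MathematicalPhysics.QuantumFieldTheory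
open Literature.MathematicalPhysics.QuantumLattice.SchwingerFamily (timeVec)

namespace Summit.QuantumFields.YangMills.Theorems.CurvatureKernel

/-! ## H. The stub -/

/-- **Stub `HalfSpaceKernel`** (registered signature verbatim). Axis reflection positivity (E2) + translation
invariance on `⁰𝒮` + local two-point bounds at every base height `s ∈ (0,s₁)` ⇒ ONE kernel `K`, continuous on
`{ξ⁰ < 0}`, bounded on `{ξ⁰ ≤ −2s}` by the constants at height `s` (`c₀ = 2⁸/(∫ϖ)²`), representing `S₁ 2` on the
complex tensors supported near every configuration `(z₀,z₁)` with `z₀⁰ < 0 < z₁⁰`. Construction: bump vectors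
`w⁽ᵖ⁾ₙ = (Δₙ⁴∫ϖ)⁻¹Ψ_{ϖ((·−pe₀)/Δₙ)}` (bounded by the local bound at height `p`), a weak cluster vector `Ψₚ` along a
fixed ultrafilter (consistent: `Ψ_{p'} = e^{-(p'−p)H}Ψₚ`), `K(ξ) = ⟪Ψₚ, e^{-(−ξ⁰−2p)H}U(−ξ⃗)Ψₚ⟫` for any admissible
`p`; continuity from the strong continuity of `e^{-tH}`, `U(a⃗)`; the representation from
`two_point_tensor_eq_integral`. [OsterwalderSchrader1973 §4; folklore] -/
theorem HalfSpaceKernel : open Literature.MathematicalPhysics.QuantumLattice Literature.MathematicalPhysics.AQFT Literature.MathematicalPhysics.QuantumFieldTheory in ((∃ ϖ : (EuclideanSpace ℝ (Fin 4)) → ℝ, ContDiff ℝ (⊤ : ℕ∞) ϖ ∧ (∀ x, 0 ≤ ϖ x) ∧ (∀ x, ϖ x ≤ 1) ∧ tsupport ϖ ⊆ Metric.closedBall (0 : (EuclideanSpace ℝ (Fin 4))) 2 ∧ 0 < ∫ x, ϖ x ∧ (∀ (N : ℕ) (y : (EuclideanSpace ℝ (Fin 4))), ∑ j ∈ Fintype.piFinset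 (fun _ : Fin 4 => Finset.Icc (-(N : ℤ)) N), ϖ (y - WithLp.toLp 2 (fun i => ((j i : ℤ) : ℝ))) ≤ 1) ∧ (∀ (N : ℕ) (y : (EuclideanSpace ℝ (Fin 4))), (∀ i : Fin 4, |y i| ≤ N) → ∑ j ∈ Fintype.piFinset (fun _ : Fin 4 => Finset.Icc (-(N : ℤ)) N), ϖ (y - WithLp.toLp 2 (fun i => ((j i : ℤ) : ℝ))) = 1))) → ∀ (S₁ : SchwingerFamily (EuclideanSpace ℝ (Fin 4))), S₁.toLabelled.IsReflectionPositive → (∀ (n : ℕ) (a : (EuclideanSpace ℝ (Fin 4))) (F : SchwartzMap (Fin n → (EuclideanSpace ℝ (Fin 4))) ℂ), IsOffDiagonal F → S₁ n (translateMulti a F) = S₁ n F) → ∀ (s₁ : ℝ), 0 < s₁ → (∀ (s : ℝ), 0 < s → s < s₁ → ∃ (r₀ A B : ℝ), 0 < r₀ ∧ 0 ≤ A ∧ 0 ≤ B ∧ (∀ (r : ℝ), 0 < r → r ≤ r₀ → ∀ (f : Fin 2 → SchwartzMap (EuclideanSpace ℝ (Fin 4)) ℝ) (F : SchwartzMap (Fin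 2 → (EuclideanSpace ℝ (Fin 4))) ℂ) (M₀ M₁ : ℝ), IsTensorOf F (fun i => ofRealTest (f i)) → tsupport ((f 0 : SchwartzMap (EuclideanSpace ℝ (Fin 4)) ℝ) : (EuclideanSpace ℝ (Fin 4)) → ℝ) ⊆ Metric.closedBall (EuclideanSpace.single (0 : Fin 4) (-s)) r → tsupport ((f 1 : SchwartzMap (EuclideanSpace ℝ (Fin 4)) ℝ) : (EuclideanSpace ℝ (Fin 4)) → ℝ) ⊆ Metric.closedBall (EuclideanSpace.single (0 : Fin 4) s) r → (∀ x, |f 0 x| ≤ M₀) → (∀ x, |f 1 x| ≤ M₁) → ‖S₁ 2 F‖ ≤ A * (∫ x : (EuclideanSpace ℝ (Fin 4)), |f 0 x|) * (∫ x : (EuclideanSpace ℝ (Fin 4)), |f 1 x|) + B * r ^ 8 * M₀ * M₁)) → ∃ (K : (EuclideanSpace ℝ (Fin 4)) → ℂ) (c₀ : ℝ), 0 ≤ c₀ ∧ ContinuousOn K {ξ : (EuclideanSpace ℝ (Fin 4)) | ξ 0 < 0} ∧ (∀ (s r₀ A B : ℝ), 0 < s → s < s₁ → 0 < r₀ → 0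 ≤ A → 0 ≤ B → (∀ (r : ℝ), 0 < r → r ≤ r₀ → ∀ (f : Fin 2 → SchwartzMap (EuclideanSpace ℝ (Fin 4)) ℝ) (F : SchwartzMap (Fin 2 → (EuclideanSpace ℝ (Fin 4))) ℂ) (M₀ M₁ : ℝ), IsTensorOf F (fun i => ofRealTest (f i)) → tsupport ((f 0 : SchwartzMap (EuclideanSpace ℝ (Fin 4)) ℝ) : (EuclideanSpace ℝ (Fin 4)) → ℝ) ⊆ Metric.closedBall (EuclideanSpace.single (0 : Fin 4) (-s)) r → tsupport ((f 1 : SchwartzMap (EuclideanSpace ℝ (Fin 4)) ℝ) : (EuclideanSpace ℝ (Fin 4)) → ℝ) ⊆ Metric.closedBall (EuclideanSpace.single (0 : Fin 4) s) r → (∀ x, |f 0 x| ≤ M₀) → (∀ x, |f 1 x| ≤ M₁) → ‖S₁ 2 F‖ ≤ A * (∫ x : (EuclideanSpace ℝ (Fin 4)), |f 0 x|) * (∫ x : (EuclideanSpace ℝ (Fin 4)), |f 1 x|) + B * r ^ 8 * M₀ * M₁) → ∀ ξ : (EuclideanSpace ℝ (Fin 4)), ξ 0 ≤ -(2 * s)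 → ‖K ξ‖ ≤ A + c₀ * B) ∧ (∀ z : Fin 2 → (EuclideanSpace ℝ (Fin 4)), z 0 0 < 0 → 0 < z 1 0 → ∃ r : ℝ, 0 < r ∧ ∀ (f g : SchwartzMap (EuclideanSpace ℝ (Fin 4)) ℂ), tsupport (f : (EuclideanSpace ℝ (Fin 4)) → ℂ) ⊆ Metric.ball (z 0) r → tsupport (g : (EuclideanSpace ℝ (Fin 4)) → ℂ) ⊆ Metric.ball (z 1) r → ∀ F : SchwartzMap (Fin 2 → (EuclideanSpace ℝ (Fin 4))) ℂ, IsTensorOf F ![f, g] → MeasureTheory.Integrable (fun x : Fin 2 → (EuclideanSpace ℝ (Fin 4)) => K (x 0 - x 1) * F x) ∧ S₁ 2 F = ∫ x : Fin 2 → (EuclideanSpace ℝ (Fin 4)), K (x 0 - x 1) * F x) := by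
  intro hϖex S hE2 htr s₁ hs₁ hfam
  obtain ⟨ϖ, hϖs, hϖ0, hϖ1, hϖsupp, hI, hϖle, hϖeq⟩ := hϖex
  have hϖc : Continuous ϖ := hϖs.continuous
  have h : OSReconstructionNoE1 S.toLabelled := ⟨hE2, fun n _ a F hF => htr n a F hF⟩
  obtain ⟨b, hb⟩ := exists_scaledBumps ϖ hϖs hϖsupp
  set I : ℝ := ∫ x, ϖ x with hIdef
  let 𝒰 : Ultrafilter ℕ := Ultrafilter.of atTop
  have h𝒰 : (↑𝒰 : Filter ℕ) ≤ atTop := Ultrafilter.of_le _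
  haveI : (↑𝒰 : Filter ℕ).NeBot := Ultrafilter.neBot 𝒰
  -- time components of `t e₀`
  have hsingle : ∀ t : ℝ, (EuclideanSpace.single (0 : Fin 4) t : EuclideanSpace ℝ (Fin 4)) 0 = t := fun t => by simp
  -- the scales tend to zero
  have hΔ : Tendsto (fun n : ℕ => 2 * ((n : ℝ) + 2)⁻¹) atTop (𝓝 0) := by
    have h1 : Tendsto (fun n : ℕ => ((n : ℝ) + 2)⁻¹) atTop (𝓝 0) :=
      tendsto_inv_atTop_zero.comp (tendsto_natCast_atTop_atTop.atTop_add tendsto_const_nhds)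
    simpa using h1.const_mul 2
  -- ### the bump vectors at height `p`
  let w : ℝ → ℕ → h.Hilbert := fun p n =>
    if hn : 2 * ((n : ℝ) + 2)⁻¹ < (EuclideanSpace.single (0 : Fin 4) p : EuclideanSpace ℝ (Fin 4)) 0 then
      ((((((n : ℝ) + 2)⁻¹) ^ 4 * ∫ x, ϖ x)⁻¹ : ℝ) : ℂ) •
        h.fieldVec 1 (fun _ => ()) _ (isTimeOrdered_tensorFin_one (tsupport_ofRealTest_bump_pos ϖ hϖsupp b hb n hn))
    else 0
  have hw : ∀ (p : ℝ) (n : ℕ) (hn : 2 * ((n : ℝ) + 2)⁻¹ < (EuclideanSpace.single (0 : Fin 4) p : EuclideanSpace ℝ (Fin 4)) 0),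
      w p n = ((((((n : ℝ) + 2)⁻¹) ^ 4 * ∫ x, ϖ x)⁻¹ : ℝ) : ℂ) •
        h.fieldVec 1 (fun _ => ()) _ (isTimeOrdered_tensorFin_one (tsupport_ofRealTest_bump_pos ϖ hϖsupp b hb n hn)) :=
    fun p n hn => dif_pos hn
  -- ### eventual norm bound from ANY local bound at height `p`
  have hwbound : ∀ (p r₀ A B : ℝ), 0 < p → 0 < r₀ → 0 ≤ A → 0 ≤ B → (∀ (r : ℝ), 0 < r → r ≤ r₀ → ∀ (f : Fin 2 → SchwartzMap (EuclideanSpace ℝ (Fin 4)) ℝ) (F : SchwartzMap (Fin 2 → (EuclideanSpace ℝ (Fin 4))) ℂ) (M₀ M₁ : ℝ), IsTensorOf F (fun i => ofRealTest (f i)) → tsupport ((f 0 : SchwartzMap (EuclideanSpace ℝ (Fin 4)) ℝ) : (EuclideanSpace ℝ (Fin 4)) → ℝ) ⊆ Metric.closedBall (EuclideanSpace.single (0 : Fin 4) (-p)) r → tsupport ((f 1 : SchwartzMap (EuclideanSpace ℝ (Fin 4)) ℝ) : (EuclideanSpace ℝ (Fin 4)) → ℝ) ⊆ Metric.closedBall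 (EuclideanSpace.single (0 : Fin 4) p) r → (∀ x, |f 0 x| ≤ M₀) → (∀ x, |f 1 x| ≤ M₁) → ‖S 2 F‖ ≤ A * (∫ x : (EuclideanSpace ℝ (Fin 4)), |f 0 x|) * (∫ x : (EuclideanSpace ℝ (Fin 4)), |f 1 x|) + B * r ^ 8 * M₀ * M₁) →
      ∀ᶠ n in atTop, ‖w p n‖ ≤ Real.sqrt (A + 2 ^ 8 / I ^ 2 * B) := by
    intro p r₀ A B hp hr₀ hA hB hLB
    have hev : ∀ᶠ n : ℕ in atTop, 2 * ((n : ℝ) + 2)⁻¹ < min p r₀ :=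
      hΔ.eventually (gt_mem_nhds (lt_min hp hr₀))
    filter_upwards [hev] with n hn
    have hnp : 2 * ((n : ℝ) + 2)⁻¹ < (EuclideanSpace.single (0 : Fin 4) p : EuclideanSpace ℝ (Fin 4)) 0 := by
      rw [hsingle]; exact lt_of_lt_of_le hn (min_le_left _ _)
    have hnr : 2 * ((n : ℝ) + 2)⁻¹ ≤ r₀ := (lt_of_lt_of_le hn (min_le_right _ _)).le
    have hV := norm_bumpVec_sq_le ϖ hϖ0 hϖ1 hϖsupp b hb h p r₀ A B hLB n hnp hnr
    rw [hw p n hnp, norm_smul]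
    set Δ : ℝ := ((n : ℝ) + 2)⁻¹ with hΔdef
    have hΔpos : 0 < Δ := by positivity
    have hm : 0 < Δ ^ 4 * I := by positivity
    rw [Complex.norm_real, Real.norm_eq_abs, abs_inv, abs_of_pos hm]
    refine (Real.le_sqrt (by positivity) (by positivity)).2 ?_
    rw [mul_pow]
    calc (Δ ^ 4 * I)⁻¹ ^ 2 * ‖h.fieldVec 1 (fun _ => ()) _
          (isTimeOrdered_tensorFin_one (tsupport_ofRealTest_bump_pos ϖ hϖsupp b hb n hnp))‖ ^ 2
        ≤ (Δ ^ 4 * I)⁻¹ ^ 2 * (A * (Δ ^ 4 * ∫ x, ϖ x) ^ 2 + B * (2 * Δ) ^ 8) :=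
          mul_le_mul_of_nonneg_left hV (by positivity)
      _ = A + 2 ^ 8 / I ^ 2 * B := by rw [← hIdef]; field_simp
  -- a uniform bound at every height in `(0, s₁)`
  have hCw : ∀ p, 0 < p → p < s₁ → ∃ Cw : ℝ, ∀ n, ‖w p n‖ ≤ Cw := by
    intro p hp hps
    obtain ⟨r₀, A, B, hr₀, hA, hB, hLB⟩ := hfam p hp hps
    exact exists_forall_norm_le_of_eventually (w p) (Real.sqrt_nonneg _) (hwbound p r₀ A B hp hr₀ hA hB hLB)
  -- ### the weak cluster vectors `Ψ p`
  have hΨex : ∀ p, 0 < p → p < s₁ → ∃ Ψ : h.Hilbert, ∀ Φ : h.Hilbert,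
      Tendsto (fun n => ⟪Φ, w p n⟫_ℂ) (↑𝒰 : Filter ℕ) (𝓝 ⟪Φ, Ψ⟫_ℂ) := by
    intro p hp hps
    obtain ⟨Cw, hCw'⟩ := hCw p hp hps
    obtain ⟨Ψ, -, hΨ⟩ := exists_weak_cluster_vector 𝒰 (w p) Cw hCw'
    exact ⟨Ψ, hΨ⟩
  choose! Ψf hΨf using hΨex
  -- norm of the cluster vector from any local bound
  have hΨnorm : ∀ (p r₀ A B : ℝ), 0 < p → p < s₁ → 0 < r₀ → 0 ≤ A → 0 ≤ B → (∀ (r : ℝ), 0 < r → r ≤ r₀ → ∀ (f : Fin 2 → SchwartzMap (EuclideanSpace ℝ (Fin 4)) ℝ) (F : SchwartzMap (Fin 2 → (EuclideanSpace ℝ (Fin 4))) ℂ) (M₀ M₁ : ℝ), IsTensorOf F (fun i => ofRealTest (f i)) → tsupport ((f 0 : SchwartzMap (EuclideanSpace ℝ (Fin 4)) ℝ) : (EuclideanSpace ℝ (Fin 4)) → ℝ) ⊆ Metric.closedBall (EuclideanSpace.single (0 : Fin 4) (-p)) r → tsupport ((f 1 : SchwartzMap (EuclideanSpace ℝ (Fin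 4)) ℝ) : (EuclideanSpace ℝ (Fin 4)) → ℝ) ⊆ Metric.closedBall (EuclideanSpace.single (0 : Fin 4) p) r → (∀ x, |f 0 x| ≤ M₀) → (∀ x, |f 1 x| ≤ M₁) → ‖S 2 F‖ ≤ A * (∫ x : (EuclideanSpace ℝ (Fin 4)), |f 0 x|) * (∫ x : (EuclideanSpace ℝ (Fin 4)), |f 1 x|) + B * r ^ 8 * M₀ * M₁) →
      ‖Ψf p‖ ^ 2 ≤ A + 2 ^ 8 / I ^ 2 * B := by
    intro p r₀ A B hp hps hr₀ hA hB hLB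
    have h1 := norm_le_of_tendsto_inner (hΨf p hp hps) (Real.sqrt_nonneg _)
      ((hwbound p r₀ A B hp hr₀ hA hB hLB).filter_mono h𝒰)
    calc ‖Ψf p‖ ^ 2 ≤ Real.sqrt (A + 2 ^ 8 / I ^ 2 * B) ^ 2 := pow_le_pow_left₀ (norm_nonneg _) h1 2
      _ = A + 2 ^ 8 / I ^ 2 * B := Real.sq_sqrt (by positivity)
  -- ### consistency of the cluster vectors: `Ψ p' = e^{-(p'-p)H} Ψ p`
  have hcons : ∀ p p', 0 < p → p ≤ p' → p' < s₁ → Ψf p' = h.transfer (p' - p) (Ψf p) := by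
    intro p p' hp hpp' hps'
    have hp' : 0 < p' := lt_of_lt_of_le hp hpp'
    have hps : p < s₁ := lt_of_le_of_lt hpp' hps'
    -- eventually `w p' n = e^{-(p'-p)H} (w p n)`
    have hev : ∀ᶠ n : ℕ in atTop, w p' n = h.transfer (p' - p) (w p n) := by
      filter_upwards [hΔ.eventually (gt_mem_nhds hp)] with n hn
      have hnp : 2 * ((n : ℝ) + 2)⁻¹ < (EuclideanSpace.single (0 : Fin 4) p : EuclideanSpace ℝ (Fin 4)) 0 := by
        rw [hsingle]; exact hn
      have hnp' : 2 * ((n : ℝ) + 2)⁻¹ < (EuclideanSpace.single (0 : Fin 4) p' : EuclideanSpace ℝ (Fin 4)) 0 := by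
        rw [hsingle]; exact lt_of_lt_of_le hn hpp'
      have hT := transfer_translate_bumpVec ϖ hϖsupp b hb h n hnp hnp' (by rw [hsingle, hsingle]; exact hpp')
      have hdiff : (EuclideanSpace.single (0 : Fin 4) p' : EuclideanSpace ℝ (Fin 4)) - EuclideanSpace.single 0 p =
          EuclideanSpace.single 0 (p' - p) := by
        ext i; by_cases hi : i = 0 <;> simp [PiLp.sub_apply, hi]
      rw [hdiff, hsingle] at hT
      have htr0 : ∀ ψ : h.Hilbert, h.translate (EuclideanSpace.single (0 : Fin 4) (p' - p)) ψ = ψ := by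
        intro ψ
        rw [← h.translate_spatialPart]
        have : spatialPart 0 (EuclideanSpace.single (0 : Fin 4) (p' - p) : EuclideanSpace ℝ (Fin 4)) = 0 := by
          ext i; by_cases hi : i = 0 <;> simp [spatialPart_apply, hi]
        rw [this, h.translate_zero_apply]
      rw [htr0] at hT
      rw [hw p' n hnp', hw p n hnp, ContinuousLinearMap.map_smul, hT]
    -- pass to the limit along `𝒰`
    refine ext_inner_left ℂ fun Φ => ?_
    have h1 : Tendsto (fun n => ⟪Φ, w p' n⟫_ℂ) (↑𝒰 : Filter ℕ) (𝓝 ⟪Φ, h.transfer (p' - p) (Ψf p)⟫_ℂ) := by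
      have h2 : Tendsto (fun n => ⟪h.transfer (p' - p) Φ, w p n⟫_ℂ) (↑𝒰 : Filter ℕ)
          (𝓝 ⟪h.transfer (p' - p) Φ, Ψf p⟫_ℂ) := hΨf p hp hps _
      rw [h.inner_transfer_left] at h2
      refine h2.congr' ?_
      filter_upwards [hev.filter_mono h𝒰] with n hn
      rw [hn, h.inner_transfer_left]
    exact tendsto_nhds_unique (hΨf p' hp' hps' Φ) h1
  -- ### the kernel
  let pf : EuclideanSpace ℝ (Fin 4) → ℝ := fun ξ => min (s₁ / 2) (-(ξ 0) / 4)
  let K : EuclideanSpace ℝ (Fin 4) → ℂ := fun ξ =>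
    ⟪Ψf (pf ξ), h.transfer (-(ξ 0) - 2 * pf ξ) (h.translate (-ξ) (Ψf (pf ξ)))⟫_ℂ
  -- the value is the same for every admissible base height
  have hval : ∀ (ξ : EuclideanSpace ℝ (Fin 4)) (p p' : ℝ), 0 < p → p ≤ p' → p' < s₁ → 2 * p' ≤ -(ξ 0) →
      ⟪Ψf p', h.transfer (-(ξ 0) - 2 * p') (h.translate (-ξ) (Ψf p'))⟫_ℂ =
        ⟪Ψf p, h.transfer (-(ξ 0) - 2 * p) (h.translate (-ξ) (Ψf p))⟫_ℂ := by
    intro ξ p p' hp hpp' hps' hξ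
    rw [hcons p p' hp hpp' hps', inner_transfer_transfer_translate_transfer h (Ψf p) (by linarith) (by linarith)]
    congr 2
    ring
  have hKp : ∀ (ξ : EuclideanSpace ℝ (Fin 4)) (p : ℝ), 0 < p → p < s₁ → 2 * p ≤ -(ξ 0) →
      K ξ = ⟪Ψf p, h.transfer (-(ξ 0) - 2 * p) (h.translate (-ξ) (Ψf p))⟫_ℂ := by
    intro ξ p hp hps hξ
    have hpf : 0 < pf ξ := lt_min (by linarith) (by linarith)
    have hpfs : pf ξ < s₁ := lt_of_le_of_lt (min_le_left _ _) (by linarith)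
    have hpfξ : 2 * pf ξ ≤ -(ξ 0) := by
      have := min_le_right (s₁ / 2) (-(ξ 0) / 4); show 2 * pf ξ ≤ -(ξ 0); linarith
    show ⟪Ψf (pf ξ), h.transfer (-(ξ 0) - 2 * pf ξ) (h.translate (-ξ) (Ψf (pf ξ)))⟫_ℂ = _
    rcases le_total p (pf ξ) with hle | hle
    · exact hval ξ p (pf ξ) hp hle hpfs hpfξ
    · exact (hval ξ (pf ξ) p hpf hle hps hξ).symm
  refine ⟨K, 2 ^ 8 / I ^ 2, by positivity, ?_, ?_, ?_⟩
  · -- ### continuity on `{ξ⁰ < 0}`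
    intro ξ₀ hξ₀
    have hξ₀' : ξ₀ 0 < 0 := hξ₀
    set p₀ : ℝ := min (s₁ / 2) (-(ξ₀ 0) / 8) with hp₀
    have hp₀pos : 0 < p₀ := lt_min (by linarith) (by linarith)
    have hp₀s : p₀ < s₁ := lt_of_le_of_lt (min_le_left _ _) (by linarith)
    have hG : Continuous fun ξ : EuclideanSpace ℝ (Fin 4) =>
        ⟪Ψf p₀, h.transfer (-(ξ 0) - 2 * p₀) (h.translate (-ξ) (Ψf p₀))⟫_ℂ := by
      have hc : Continuous fun ξ : EuclideanSpace ℝ (Fin 4) => h.translate (-ξ) (h.transfer (-(ξ 0) - 2 * p₀) (Ψf p₀)) :=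
        continuous_translate_transfer_comp h (Ψf p₀)
          (((EuclideanSpace.proj (0 : Fin 4)).continuous.neg).sub continuous_const) continuous_neg
      simp_rw [← h.translate_transfer]
      exact continuous_const.inner hc
    have hN : {ξ : EuclideanSpace ℝ (Fin 4) | ξ 0 < ξ₀ 0 / 2} ∈ 𝓝 ξ₀ := by
      refine (isOpen_lt (EuclideanSpace.proj (0 : Fin 4)).continuous continuous_const).mem_nhds ?_
      show ξ₀ 0 < ξ₀ 0 / 2; linarith
    have hEq : ∀ ξ ∈ {ξ : EuclideanSpace ℝ (Fin 4) | ξ 0 < ξ₀ 0 / 2},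
        K ξ = ⟪Ψf p₀, h.transfer (-(ξ 0) - 2 * p₀) (h.translate (-ξ) (Ψf p₀))⟫_ℂ := by
      intro ξ hξ
      have hξ' : ξ 0 < ξ₀ 0 / 2 := hξ
      refine hKp ξ p₀ hp₀pos hp₀s ?_
      have := min_le_right (s₁ / 2) (-(ξ₀ 0) / 8); linarith
    refine (hG.continuousAt.congr ?_).continuousWithinAt
    exact Filter.eventuallyEq_of_mem hN fun ξ hξ => (hEq ξ hξ).symm
  · -- ### the bound on `{ξ⁰ ≤ -2s}` by the constants at height `s`
    intro s r₀ A B hs hss hr₀ hA hB hLB ξ hξ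
    rw [hKp ξ s hs hss (by linarith)]
    exact (norm_inner_transfer_translate_le h (Ψf s) _ _).trans (hΨnorm s r₀ A B hs hss hr₀ hA hB hLB)
  · -- ### the tensor representation near `z`
    intro z hz0 hz1
    set m : ℝ := min (-(z 0 0)) (z 1 0) with hm
    have hmpos : 0 < m := lt_min (by linarith) hz1
    set p : ℝ := min (s₁ / 2) (m / 2) with hpdef
    have hp : 0 < p := lt_min (by linarith) (by linarith)
    have hps : p < s₁ := lt_of_le_of_lt (min_le_left _ _) (by linarith)
    obtain ⟨r₀, A, B, hr₀, hA, hB, hLB⟩ := hfam p hp hps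
    set R : ℝ := min (p / 4) (r₀ / 4) with hRdef
    have hR : 0 < R := lt_min (by linarith) (by linarith)
    have hRr : 4 * R ≤ r₀ := by have := min_le_right (p / 4) (r₀ / 4); linarith
    have hRp : 4 * R ≤ p := by have := min_le_left (p / 4) (r₀ / 4); linarith
    have hpm : p ≤ m / 2 := min_le_right _ _
    have hz0' : p + 2 * R ≤ -(z 0 0) := by have := min_le_left (-(z 0 0)) (z 1 0); linarith
    have hz1' : p + 2 * R ≤ z 1 0 := by have := min_le_right (-(z 0 0)) (z 1 0); linarith
    obtain ⟨Cw, hCw'⟩ := hCw p hp hps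
    refine ⟨R, hR, fun f g hf hg F hF => ?_⟩
    exact two_point_tensor_eq_integral ϖ hϖc hϖ0 hϖsupp hϖle hϖeq hI b hb h htr 𝒰 h𝒰 p r₀ A B hA hB hLB
      (w p) (hw p) Cw hCw' (Ψf p) (hΨf p hp hps) K (fun ξ hξ => hKp ξ p hp hps (by linarith)) z R hR hRr hRp
      hz0' hz1' f g hf hg F hF


end Summit.QuantumFields.YangMills.Theorems.CurvatureKernel

end
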